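import Mathlib

/-!
# LEMMA MH (`MultiHubRigid q p`) for `p ∤ q − 1` — in particular for every ODD admissible prime `p` (cell bsd-f2-manin, analytic lens g30,
# MEMO-an §72.10 / Sketch-an-g30 §7 / PROOFS-an-72 §5 (5.4c); the finite-group rigidity behind E-an-142 `TVPatternRigidity`)

Summit `BirchSwinnertonDyer`, route `ManinLocalTwoThree`, cruxes C3 `ManinPrimeToThreeAtNine` (stmt-BirchSwinnertonDyer-22968; `p = 3`) / C2
`ManinOddAtFour` (stmt-…-22967; `p = 2`).  an's LEMMA MH: an even `G : ℤ/q → ℤ/p` satisfying the MULTI-HUB relation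
`G(h) − G(hD) − G(h(1−D)/D) + G(h(1−D)) = 0` (`h ≠ 0`, `D ∉ {0,1}`) is constant on `(ℤ/q)ˣ` iff `p ∤ (q−1)/2`.  This file proves the case
`p ∤ q − 1` — which for an ODD prime `p` is the same as `p ∤ (q−1)/2` — by TELESCOPING (no characters): with `h = λw`, `D = (w−1)/w` the
relation reads `G(λw) − G(λ(w−1)) = G(λ·w/(w−1)) − G(λ)`; summing over `w ∉ {0,1}` the left side telescopes to `G(−λ) − G(λ) = 0` (evenness),
`w ↦ w/(w−1)` permutes `ℤ/q ∖ {0,1}`, whence `(q−1)·G(λ) = Σ_{u} G(u) − G(0)` for every `λ ≠ 0`, and `G` is constant on the units as soon as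
`q − 1` is invertible mod `p`.

* `multiHubRigid_of_not_dvd_sub_one` — `MultiHubRigid q p` (Sketch-an-g30 §7 VERBATIM, by value) for `q` prime, `p` prime, `p ∤ q − 1`;
* `multiHubRigid_of_odd` — the law `MultiHubRigidLaw` restricted to odd `p` (so all of it except `p = 2`, `q ≡ 3 (mod 4)`).

HONEST FRAMING: the case `p = 2` (needed for C2) requires the even-character argument on `(ℤ/q)ˣ/±1` (odd order) and is NOT proved here.
Nothing about Manin's conjecture or BSD is proved by this.
-/

set_option linter.dupNamespace false
set_option autoImplicit false

namespace Summit.BirchSwinnertonDyer.BirchSwinnertonDyer.Theorems.ManinLocalTwoThree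

/-- The summed multi-hub relation: for an even `G` with the multi-hub relation, `(q−1)·G(λ) = Σ_u G(u) − G(0)` for every `λ ≠ 0`. -/
theorem multiHub_sum_identity {q p : ℕ} [Fact q.Prime] (G : ZMod q → ZMod p)
    (heven : ∀ x : ZMod q, G (-x) = G x)
    (hMH : ∀ h D : ZMod q, h ≠ 0 → D ≠ 0 → D ≠ 1 → G h - G (h * D) - G (h * (1 - D) * D⁻¹) + G (h * (1 - D)) = 0)
    {lam : ZMod q} (hlam : lam ≠ 0) :
    ((q - 1 : ℕ) : ZMod p) * G lam = (∑ u : ZMod q, G u) - G 0 := by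
  have hq2 : 2 ≤ q := (Fact.out : q.Prime).two_le
  -- the index set `S = ℤ/q ∖ {0, 1}`
  set S : Finset (ZMod q) := (Finset.univ.erase 0).erase 1 with hS
  have hmemS : ∀ w : ZMod q, w ∈ S ↔ w ≠ 0 ∧ w ≠ 1 := by
    intro w; simp only [hS, Finset.mem_erase, Finset.mem_univ, and_true]; tauto
  -- the relation at `h = λ w`, `D = (w - 1)/w`
  have hrel : ∀ w ∈ S, G (lam * w) - G (lam * (w - 1)) - G (lam * (w * (w - 1)⁻¹)) + G lam = 0 := by
    intro w hw
    obtain ⟨hw0, hw1⟩ := (hmemS w).mp hw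
    have hw1' : w - 1 ≠ 0 := sub_ne_zero.mpr hw1
    have h := hMH (lam * w) ((w - 1) * w⁻¹) (mul_ne_zero hlam hw0)
      (mul_ne_zero hw1' (inv_ne_zero hw0)) (by
        intro h1
        have : (w - 1) * w⁻¹ * w = w := by rw [h1, one_mul]
        rw [inv_mul_cancel_right₀ hw0] at this
        exact absurd (sub_eq_self.mp this) one_ne_zero)
    have e1 : lam * w * ((w - 1) * w⁻¹) = lam * (w - 1) := by field_simp
    have e2 : lam * w * (1 - (w - 1) * w⁻¹) * ((w - 1) * w⁻¹)⁻¹ = lam * (w * (w - 1)⁻¹) := by field_simp; ring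
    have e3 : lam * w * (1 - (w - 1) * w⁻¹) = lam := by field_simp; ring
    rw [e1, e2, e3] at h
    exact h
  have hsum := Finset.sum_eq_zero hrel
  -- evaluate the four sums
  have hTall : ∀ μ : ZMod q, μ ≠ 0 → ∑ w : ZMod q, G (μ * w) = ∑ u : ZMod q, G u := by
    intro μ hμ
    exact Equiv.sum_comp (Equiv.mulLeft₀ μ hμ) G
  have h1 : ∑ w ∈ S, G (lam * w) = (∑ u : ZMod q, G u) - G 0 - G lam := by
    have e0 : (0 : ZMod q) ∈ Finset.univ := Finset.mem_univ _
    have e1 : (1 : ZMod q) ∈ Finset.univ.erase (0 : ZMod q) := by simp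
    rw [hS, Finset.sum_erase_eq_sub e1, Finset.sum_erase_eq_sub e0, mul_one, mul_zero, hTall lam hlam]
  have h2 : ∑ w ∈ S, G (lam * (w - 1)) = (∑ u : ZMod q, G u) - G (-lam) - G 0 := by
    have e0 : (0 : ZMod q) ∈ Finset.univ := Finset.mem_univ _
    have e1 : (1 : ZMod q) ∈ Finset.univ.erase (0 : ZMod q) := by simp
    rw [hS, Finset.sum_erase_eq_sub e1, Finset.sum_erase_eq_sub e0, sub_self, mul_zero, zero_sub, mul_neg, mul_one]
    have : ∑ w : ZMod q, G (lam * (w - 1)) = ∑ u : ZMod q, G u := by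
      rw [← hTall lam hlam]
      exact Equiv.sum_comp (Equiv.subRight (1 : ZMod q)) (fun w ↦ G (lam * w))
    rw [this]
  have h3 : ∑ w ∈ S, G (lam * (w * (w - 1)⁻¹)) = (∑ u : ZMod q, G u) - G 0 - G lam := by
    rw [← h1]
    -- `w ↦ w/(w-1)` is an involution of `S`
    refine Finset.sum_bij' (fun w _ ↦ w * (w - 1)⁻¹) (fun w _ ↦ w * (w - 1)⁻¹) ?_ ?_ ?_ ?_ ?_
    · intro w hw
      obtain ⟨hw0, hw1⟩ := (hmemS w).mp hw
      have hw1' : w - 1 ≠ 0 := sub_ne_zero.mpr hw1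
      refine (hmemS _).mpr ⟨mul_ne_zero hw0 (inv_ne_zero hw1'), ?_⟩
      intro h
      have : w = w - 1 := by
        have := congrArg (· * (w - 1)) h
        simpa [inv_mul_cancel_right₀ hw1'] using this
      exact absurd (sub_eq_self.mp this.symm) one_ne_zero
    · intro w hw
      obtain ⟨hw0, hw1⟩ := (hmemS w).mp hw
      have hw1' : w - 1 ≠ 0 := sub_ne_zero.mpr hw1
      refine (hmemS _).mpr ⟨mul_ne_zero hw0 (inv_ne_zero hw1'), ?_⟩
      intro h
      have : w = w - 1 := by
        have := congrArg (· * (w - 1)) h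
        simpa [inv_mul_cancel_right₀ hw1'] using this
      exact absurd (sub_eq_self.mp this.symm) one_ne_zero
    · intro w hw
      obtain ⟨hw0, hw1⟩ := (hmemS w).mp hw
      have hw1' : w - 1 ≠ 0 := sub_ne_zero.mpr hw1
      have hden : w * (w - 1)⁻¹ - 1 ≠ 0 := by
        rw [sub_ne_zero]
        intro h
        have : w = w - 1 := by
          have := congrArg (· * (w - 1)) h
          simpa [inv_mul_cancel_right₀ hw1'] using this
        exact absurd (sub_eq_self.mp this.symm) one_ne_zero
      field_simp
      ring
    · intro w hw
      obtain ⟨hw0, hw1⟩ := (hmemS w).mp hw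
      have hw1' : w - 1 ≠ 0 := sub_ne_zero.mpr hw1
      have : w * (w - 1)⁻¹ - 1 = (w - 1)⁻¹ := by field_simp; ring
      rw [this, inv_inv]
      field_simp
    · intro w hw
      rfl
  have h4 : ∑ w ∈ S, G lam = ((q - 2 : ℕ) : ZMod p) * G lam := by
    rw [Finset.sum_const, nsmul_eq_mul]
    congr 1
    have hcard : S.card = q - 2 := by
      rw [hS, Finset.card_erase_of_mem (by simp), Finset.card_erase_of_mem (Finset.mem_univ _), Finset.card_univ,
        ZMod.card]
      omega
    rw [hcard]
  rw [Finset.sum_add_distrib, Finset.sum_sub_distrib, Finset.sum_sub_distrib, h1, h2, h3, h4, heven] at hsum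
  -- `hsum : T − G0 − Gλ − (T − Gλ − G0) − (T − G0 − Gλ) + (q−2) Gλ = 0`
  have hq : ((q - 1 : ℕ) : ZMod p) = ((q - 2 : ℕ) : ZMod p) + 1 := by
    have : q - 1 = (q - 2) + 1 := by omega
    rw [this]; push_cast; ring
  rw [hq]
  linear_combination hsum

/-- **LEMMA MH for `p ∤ q − 1`** (`MultiHubRigid q p` of Sketch-an-g30 §7, VERBATIM by value): an even `G : ℤ/q → ℤ/p` with the multi-hub
relation is constant on `(ℤ/q)ˣ`, provided `q` is prime and the prime `p` does not divide `q − 1`. -/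
theorem multiHubRigid_of_not_dvd_sub_one {q p : ℕ} (hq : q.Prime) (hp : p.Prime) (hpq : ¬ p ∣ q - 1) :
    ∀ G : ZMod q → ZMod p,
      (∀ x : ZMod q, G (-x) = G x) →
      (∀ h D : ZMod q, h ≠ 0 → D ≠ 0 → D ≠ 1 →
          G h - G (h * D) - G (h * (1 - D) * D⁻¹) + G (h * (1 - D)) = 0) →
      ∀ x y : ZMod q, x ≠ 0 → y ≠ 0 → G x = G y := by
  haveI : Fact q.Prime := ⟨hq⟩
  haveI : Fact p.Prime := ⟨hp⟩
  intro G heven hMH x y hx hy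
  have hx' := multiHub_sum_identity G heven hMH hx
  have hy' := multiHub_sum_identity G heven hMH hy
  have hunit : ((q - 1 : ℕ) : ZMod p) ≠ 0 := by
    rw [Ne, ZMod.natCast_eq_zero_iff]
    exact hpq
  have h : ((q - 1 : ℕ) : ZMod p) * (G x - G y) = 0 := by rw [mul_sub, hx', hy', sub_self]
  rcases mul_eq_zero.mp h with h0 | h0
  · exact absurd h0 hunit
  · exact sub_eq_zero.mp h0

/-- **`MultiHubRigidLaw` for odd `p`** (Sketch-an-g30 §7 by value, all binders kept): for an ODD prime `p`, `p ∤ (q−1)/2` is the same as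
`p ∤ q − 1`, so LEMMA MH holds by telescoping.  (The case `p = 2`, `q ≡ 3 (mod 4)` is the one needing characters of `(ℤ/q)ˣ/±1`.) -/
theorem multiHubRigid_of_odd (q p : ℕ) (hq : q.Prime) (hp : p.Prime) (_h3 : 3 ≤ q) (_hqp : q ≠ p)
    (hadm : ¬ p ∣ (q - 1) / 2) (hp2 : p ≠ 2) :
    ∀ G : ZMod q → ZMod p,
      (∀ x : ZMod q, G (-x) = G x) →
      (∀ h D : ZMod q, h ≠ 0 → D ≠ 0 → D ≠ 1 →
          G h - G (h * D) - G (h * (1 - D) * D⁻¹) + G (h * (1 - D)) = 0) →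
      ∀ x y : ZMod q, x ≠ 0 → y ≠ 0 → G x = G y := by
  refine multiHubRigid_of_not_dvd_sub_one hq hp ?_
  intro hdvd
  -- `q - 1 = 2 · ((q-1)/2)` or `2 · ((q-1)/2) + 1`; an odd prime dividing `q − 1` divides `(q − 1)/2` in the first case,
  -- and in the second case `q − 1` is odd, so `q = 2`, `q − 1 = 1`, `p ∣ 1`: impossible.
  rcases Nat.even_or_odd (q - 1) with hev | hodd
  · obtain ⟨k, hk⟩ := hev
    have hk' : (q - 1) / 2 = k := by omega
    rw [hk'] at hadm
    rw [hk, ← two_mul] at hdvd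
    rcases (Nat.Prime.dvd_mul hp).mp hdvd with h2 | h2
    · have : p ≤ 2 := Nat.le_of_dvd two_pos h2
      have := hp.two_le
      omega
    · exact hadm h2
  · obtain ⟨k, hk⟩ := hodd
    have hq1 : q - 1 = 1 := by
      rcases hq.eq_one_or_self_of_dvd 2 (by
        have : q % 2 = 0 := by omega
        exact Nat.dvd_of_mod_eq_zero this) with h | h
      · omega
      · omega
    rw [hq1] at hdvd
    exact hp.one_lt.ne' (Nat.dvd_one.mp hdvd)

end Summit.BirchSwinnertonDyer.BirchSwinnertonDyer.Theorems.ManinLocalTwoThree
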